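import Mathlib
import HarnessLib
import Literature.Probability.MarkovChains.MultipleTryIndependenceSampler
import Literature.Probability.MarkovChains.RelaxationTime

/-!
# Yang–Liu: the spectrum of the multiple-try Metropolized independence sampler lies in the range
# of its rejection-probability function — every eigenvalue `λ ≠ 1` of MTM-IS(`k`) is a rejection
# probability `R(x)`, hence real, in `[0, 1 − H_k(W)]` (finite state spaces)

[cite: YangLiu2021, §2.3 Theorem 2.2 ("Let `K` be the transition operator defined by the
MTM-IS(`k`) algorithm … Then `σ(K₀) ⊆ ess-ran(R)`, where `R` is the function of rejection
probability"), and the paragraph after it ("an upper bound of `R(x)` is `1 − H_k(w⋆)`. This implies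
that there is a gap between `1` and the upper edge `1 − H(w⋆)` of the spectrum"); §3.1 ("the
spectral radius of `K₀` … is bounded by `1 − H(w⋆)`")]

Finite, label-free form in the vocabulary of `MultipleTryIndependenceSampler.lean` (`mtmisKernel`,
`mtmisStay = R`, `mtmH = H_k`) and `RelaxationTime.lean` (`nontrivialEigenvalues`, `lambdaStar`,
`relaxationTime`), by the order-free argument used for Liu's theorem in
`IndependenceSamplerSpectrum.lean`: if `A f = μ f` with `μ ≠ 1`, pick a state `j` of maximal weight in
the support of `f`; towards every other support state the row-`j` entry is `H_k(w_j) p_y`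
(`mtmisKernel_eq`, `H_k` decreasing), `Σ p f = 0`, and the row collapses to `μ f_j = R(j) f_j`.

## Content

* **`mtmis_eigenvalue_eq_stay`** — every eigenvalue `μ ≠ 1` equals `R(j)` for a maximal-weight
  support state `j`; `mtmis_nontrivialEigenvalues_subset` — `σ(A) ∖ {1} ⊆ {R(x) : x ∈ X}`
  (THEOREM 2.2, finite form).
* `mtmisStay_le_one_sub_mtmH` — `R(x) ≤ 1 − H_k(W)` for `p ≤ W q`.
* **`mtmis_norm_le_of_mem_nontrivialEigenvalues`** — every eigenvalue `μ ≠ 1` is real, `≥ 0` and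
  `≤ 1 − H_k(W)`; `mtmis_lambdaStar_le` (`λ⋆ ≤ 1 − H_k(W)`), `mtmis_relaxationTime_le`
  (`t_rel ≤ 1/H_k(W)`).

NOT CLAIMED: that every `R(x)` IS an eigenvalue (the equality case of Theorem 2.2, which needs the
no-ties proviso), eigenvectors, general state spaces.
-/

namespace Literature.Probability.MarkovChains

open Finset

variable {X : Type*} [Fintype X] [DecidableEq X] {p q : X → ℝ} {W : ℝ}

/-- **THEOREM 2.2 (finite, label-free)**: every complex eigenvalue `μ ≠ 1` of the MTM-IS(`n+1`)
matrix (`A f = μ f`, `f ≠ 0`) is a rejection probability: `μ = R(j)` for any state `j` of maximal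
weight among those with `f j ≠ 0`. [cite: YangLiu2021, §2.3 Theorem 2.2 (`σ(K₀) ⊆ ess-ran(R)`)] -/
theorem mtmis_eigenvalue_eq_stay (hp : ∀ x, 0 < p x) (hq : ∀ x, 0 < q x) (hq1 : ∑ x, q x = 1)
    (n : ℕ) {f : X → ℂ} {μ : ℂ}
    (hf : ∀ x, ∑ y, (mtmisKernel q p n x y : ℂ) * f y = μ * f x) (hf0 : f ≠ 0) (hμ : μ ≠ 1) :
    ∃ j, f j ≠ 0 ∧ (∀ y, f y ≠ 0 → p y / q y ≤ p j / q j) ∧ μ = (mtmisStay q p n j : ℂ) := by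
  obtain ⟨x₁, hx₁⟩ : ∃ x, f x ≠ 0 := Function.ne_iff.mp hf0
  obtain ⟨j, hj, hjmax⟩ := exists_max_image (univ.filter fun x => f x ≠ 0) (fun x => p x / q x)
    ⟨x₁, mem_filter.mpr ⟨mem_univ _, hx₁⟩⟩
  have hfj : f j ≠ 0 := (mem_filter.mp hj).2
  have hmax : ∀ y, f y ≠ 0 → p y / q y ≤ p j / q j := fun y hy =>
    hjmax y (mem_filter.mpr ⟨mem_univ y, hy⟩)
  refine ⟨j, hfj, hmax, ?_⟩
  have h0 : ∑ x, (p x : ℂ) * f x = 0 :=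
    sum_mul_eigenfunction_eq_zero (mtmisKernel_isStationary hp hq hq1 n) hf hμ
  have hrow := hf j
  rw [← add_sum_erase _ _ (mem_univ j)] at hrow
  -- off-diagonal entries of row `j` towards the support: `H(w_j) p_y`
  have hoff : ∀ y ∈ univ.erase j, (mtmisKernel q p n j y : ℂ) * f y =
      ((mtmH q p n (p j / q j) : ℝ) : ℂ) * ((p y : ℂ) * f y) := by
    intro y hy
    have hyj : y ≠ j := ne_of_mem_erase hy
    by_cases hfy : f y = 0
    · rw [hfy, mul_zero, mul_zero, mul_zero]
    · rw [mtmisKernel_eq hp hq, if_neg hyj, add_zero,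
        min_eq_left (mtmH_antitone hp hq n (div_pos (hp y) (hq y)) (hmax y hfy))]
      push_cast
      ring
  rw [sum_congr rfl hoff, ← mul_sum] at hrow
  have h1 : ∑ y ∈ univ.erase j, (p y : ℂ) * f y = -((p j : ℂ) * f j) := by
    rw [← add_sum_erase _ _ (mem_univ j)] at h0
    linear_combination h0
  have hdiag : mtmisKernel q p n j j = mtmH q p n (p j / q j) * p j + mtmisStay q p n j := by
    rw [mtmisKernel_eq hp hq, min_self, if_pos rfl]
  rw [h1, hdiag] at hrow
  push_cast at hrow
  have h3 : ((mtmisStay q p n j : ℂ) - μ) * f j = 0 := by linear_combination hrow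
  rcases mul_eq_zero.mp h3 with h | h
  · exact (sub_eq_zero.mp h).symm
  · exact absurd h hfj

/-- Hence `σ(A) ∖ {1} ⊆ {R(x) : x ∈ X}`: the eigenvalues `≠ 1` of MTM-IS lie in the range of the
rejection-probability function. [cite: YangLiu2021, §2.3 Theorem 2.2] -/
theorem mtmis_nontrivialEigenvalues_subset (hp : ∀ x, 0 < p x) (hq : ∀ x, 0 < q x)
    (hq1 : ∑ x, q x = 1) (n : ℕ) :
    nontrivialEigenvalues (mtmisKernel q p n) ⊆ Set.range fun k => (mtmisStay q p n k : ℂ) := by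
  intro μ hμ
  obtain ⟨f, hf⟩ := hμ.1.exists_hasEigenvector
  obtain ⟨hf0, hfx⟩ := (hasEigenvector_iff _ f μ).mp hf
  obtain ⟨j, -, -, hj⟩ := mtmis_eigenvalue_eq_stay hp hq hq1 n hfx hf0 hμ.2
  exact ⟨j, hj.symm⟩

/-- `R(x) ≤ 1 − H_k(W)` when `p ≤ W q`: every move probability is at least `H_k(W) p(y)`.
[cite: YangLiu2021, §2.3 (after Theorem 2.2: "an upper bound of `R(x)` is `1 − H_k(w⋆)`")] -/
theorem mtmisStay_le_one_sub_mtmH (hp : ∀ x, 0 < p x) (hp1 : ∑ x, p x = 1) (hq : ∀ x, 0 < q x)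
    (hq1 : ∑ x, q x = 1) (n : ℕ) (hW : ∀ x, p x ≤ W * q x) (x : X) :
    mtmisStay q p n x ≤ 1 - mtmH q p n W := by
  have hrow := sum_mtmisMove_add_mtmisStay hp hq hq1 n x
  have hwle : ∀ z, p z / q z ≤ W := fun z => (div_le_iff₀ (hq z)).2 (hW z)
  have hmove : ∑ y, mtmH q p n W * p y ≤ ∑ y, mtmisMove q p n x y := by
    refine sum_le_sum fun y _ => ?_
    rw [mtmisMove_eq hp hq]
    exact mul_le_mul_of_nonneg_right
      (le_min (mtmH_antitone hp hq n (div_pos (hp x) (hq x)) (hwle x))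
        (mtmH_antitone hp hq n (div_pos (hp y) (hq y)) (hwle y))) (hp y).le
  rw [← mul_sum, hp1, mul_one] at hmove
  linarith

/-- **Every eigenvalue `μ ≠ 1` of MTM-IS(`k`) is real, non-negative and at most `1 − H_k(W)`**
(`p ≤ W q`). [cite: YangLiu2021, §2.3 Theorem 2.2 and the paragraph after it ("there is a gap
between `1` and the upper edge `1 − H(w⋆)` of the spectrum")] -/
theorem mtmis_norm_le_of_mem_nontrivialEigenvalues (hp : ∀ x, 0 < p x) (hp1 : ∑ x, p x = 1)
    (hq : ∀ x, 0 < q x) (hq1 : ∑ x, q x = 1) (n : ℕ) (hW : ∀ x, p x ≤ W * q x) {μ : ℂ}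
    (hμ : μ ∈ nontrivialEigenvalues (mtmisKernel q p n)) :
    ‖μ‖ ≤ 1 - mtmH q p n W := by
  obtain ⟨k, hk⟩ := mtmis_nontrivialEigenvalues_subset hp hq hq1 n hμ
  rw [← hk, Complex.norm_real, Real.norm_of_nonneg (mtmisStay_nonneg hp hq n k)]
  exact mtmisStay_le_one_sub_mtmH hp hp1 hq hq1 n hW k

/-- The eigenvalues `≠ 1` are real and non-negative: `μ = R(k) ≥ 0`.
[cite: YangLiu2021, §2.3 Theorem 2.1 (`R : X → [0,1]`), Theorem 2.2] -/
theorem mtmis_eigenvalue_real_nonneg (hp : ∀ x, 0 < p x) (hq : ∀ x, 0 < q x)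
    (hq1 : ∑ x, q x = 1) (n : ℕ) {μ : ℂ} (hμ : μ ∈ nontrivialEigenvalues (mtmisKernel q p n)) :
    ∃ r : ℝ, 0 ≤ r ∧ μ = r := by
  obtain ⟨k, hk⟩ := mtmis_nontrivialEigenvalues_subset hp hq hq1 n hμ
  exact ⟨mtmisStay q p n k, mtmisStay_nonneg hp hq n k, hk.symm⟩

/-- **`λ⋆ ≤ 1 − H_k(W)`** for MTM-IS(`k`) with `p ≤ W q`. [cite: YangLiu2021, §3.1 ("the spectral
radius of `K₀` … is bounded by `1 − H(w⋆)`")]; `λ⋆` of [cite: LevinPeres2017, §12.2 eq. (12.6)] -/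
theorem mtmis_lambdaStar_le (hp : ∀ x, 0 < p x) (hp1 : ∑ x, p x = 1) (hq : ∀ x, 0 < q x)
    (hq1 : ∑ x, q x = 1) (n : ℕ) (hW : ∀ x, p x ≤ W * q x) :
    lambdaStar (mtmisKernel q p n) ≤ 1 - mtmH q p n W := by
  obtain ⟨x₀⟩ : Nonempty X := by
    rw [← not_isEmpty_iff]
    intro hX
    rw [Finset.univ_eq_empty, Finset.sum_empty] at hp1
    exact zero_ne_one hp1
  by_cases h : (nontrivialEigenvalues (mtmisKernel q p n)).Nonempty
  · obtain ⟨μ, hμ, hμeq⟩ := exists_norm_eq_lambdaStar h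
    rw [← hμeq]
    exact mtmis_norm_le_of_mem_nontrivialEigenvalues hp hp1 hq hq1 n hW hμ
  · unfold lambdaStar
    rw [Set.not_nonempty_iff_eq_empty.mp h, Set.image_empty, Real.sSup_empty]
    linarith [mtmH_le_one hp hp1 hq hq1 n hW x₀]

/-- **`t_rel ≤ 1/H_k(W)`** for MTM-IS(`k`) with `p ≤ W q` (compare `t_rel = W` for one proposal,
`IndependenceSamplerSpectrum.imh_relaxationTime_eq`). [cite: YangLiu2021, §3.1];
`t_rel` of [cite: LevinPeres2017, §12.2] -/
theorem mtmis_relaxationTime_le (hp : ∀ x, 0 < p x) (hp1 : ∑ x, p x = 1) (hq : ∀ x, 0 < q x)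
    (hq1 : ∑ x, q x = 1) (n : ℕ) (hW : ∀ x, p x ≤ W * q x) :
    relaxationTime (mtmisKernel q p n) ≤ 1 / mtmH q p n W := by
  obtain ⟨x₀⟩ : Nonempty X := by
    rw [← not_isEmpty_iff]
    intro hX
    rw [Finset.univ_eq_empty, Finset.sum_empty] at hp1
    exact zero_ne_one hp1
  haveI : Nonempty X := ⟨x₀⟩
  have hW0 : 0 < W := pos_of_mul_pos_left ((hp x₀).trans_le (hW x₀)) (hq x₀).le
  have hH : 0 < mtmH q p n W := mtmH_pos hp hq n hW0
  unfold relaxationTime absSpectralGap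
  exact one_div_le_one_div_of_le hH (by linarith [mtmis_lambdaStar_le hp hp1 hq hq1 n hW])

end Literature.Probability.MarkovChains
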